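import Summits.QuantumAdvantage.QuantumAdvantage.Theses.CubicForrelation
import Summits.QuantumAdvantage.QuantumAdvantage.Theorems.CubicForrelationNearExactIsExactMmFormCeilingA

/-!
# `NearExactIsExact` (stmt-QuantumAdvantage-14043) — negative-side tool: ISOLATING FLATS (greedy Bose–Burton over `𝔽₂`)

The LOCAL-TO-GLOBAL step of the disprover's THEOREM BQQ^tri₃ / PC6♯ (b2b cell, DISPROOF §45): the kernel-checked
windows `BqqSeven.bqq_seven` (`m = 7`) and `BqqNineTen.bqq_nine` (`m = 9`) bound the residual of a biquadratic
Maiorana–McFarland configuration from below on every 4- resp. 6-dimensional sub-flat of the frame; to turn this into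
a bound for ALL frame orders `k` one needs, for a "defect set" `N ⊆ 𝔽₂^k` that is too small, a `j`-flat through a
given point `t ∈ N` meeting `N` in `t` only.  This is the `q = 2` case of the Bose–Burton bound ([BoseBurton1966],
R. C. Bose, R. C. Burton, J. Combin. Theory 1 (1966) 96–104, Thm. 1: a point set of `PG(k−1, 2)` meeting every `(j−1)`-space has
`≥ 2^{k−j+1} − 1` points), proved here by the elementary GREEDY argument, in coordinates:

* `lcomb j v s = Σ_i s_i v_i` — the `𝔽₂`-linear combination of `j` bit vectors `v_i ∈ 𝔽₂^k`;
* `exists_lcomb_avoiding`: if `(#Y + 1)·2^j < 2^{k+1}` then there are `v_1, …, v_j` all of whose NON-TRIVIAL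
  combinations are non-zero (linear independence) and avoid `Y` (induction on `j`: the forbidden set for the next
  vector, `(Y ∪ {0}) ⊕ span`, has `< 2^k` points);
* `exists_isolating_flat`: if `t ∈ N` and `#N · 2^j < 2^{k+1}` (i.e. `#N < 2^{k−j+1}`), some `j`-flat
  `t ⊕ span(v)` with independent `v` meets `N` only in `t`;
* `lcomb_isDegLeFun`, `chart_isDegLeFun`: the coordinates of the chart `s ↦ t ⊕ lcomb j v s` are affine
  (degree `≤ 1`) — the form in which `fc_isDegLeFun_comp` transports coordinatewise-quadratic maps and cubics to
  the sub-flat (the RESTRICTION LEMMA of §45.4, successor work).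
HONEST FRAMING: a combinatorial helper (no Forrelation content by itself); it supports the negative side of the crux
(all-`k` propagation of the BQQ windows) and asserts no Theses statement. Standard axioms only.
-/

set_option linter.dupNamespace false -- D-0017: single-problem summit ⇒ `QuantumAdvantage.QuantumAdvantage` by design

namespace Summit.QuantumAdvantage.QuantumAdvantage.Theorems.NearExactIsExact.Negative.XorSpanAvoid

open Finset
open Literature.Computability.QuantumComplexity
open Literature.Computability.QuantumComplexity.BuzetChailloux (bxor zeroVec)
open Summit.QuantumAdvantage.QuantumAdvantage.Theorems.CubicForrelation.NearExactIsExact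
  (fc_deg_bxor fc_isDegLeFun_comp)

variable {k : ℕ}

/-- `Σ_i s_i v_i ∈ 𝔽₂^k`, the linear combination of the bit vectors `v_0, …, v_{j-1}` with coefficients `s`. -/
def lcomb : (j : ℕ) → (Fin j → (Fin k → Bool)) → (Fin j → Bool) → (Fin k → Bool)
  | 0, _, _ => zeroVec
  | j + 1, v, s => fun x => lcomb j (Fin.tail v) (Fin.tail s) x ^^ (s 0 && v 0 x)

/-- Unfolding of `lcomb` at `j + 1` (split off the first vector). -/
theorem lcomb_succ (j : ℕ) (v : Fin (j + 1) → (Fin k → Bool)) (s : Fin (j + 1) → Bool) :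
    lcomb (j + 1) v s = bxor (lcomb j (Fin.tail v) (Fin.tail s)) (fun x => s 0 && v 0 x) := rfl

/-- `lcomb` of a family extended in front by `w`: `Σ = (Σ over the tail) ⊕ s₀·w`. -/
theorem lcomb_cons (j : ℕ) (w : Fin k → Bool) (v : Fin j → (Fin k → Bool)) (s : Fin (j + 1) → Bool) :
    lcomb (j + 1) (Fin.cons w v) s = bxor (lcomb j v (Fin.tail s)) (fun x => s 0 && w x) := by
  rw [lcomb_succ, Fin.tail_cons, Fin.cons_zero]

/-- **Greedy Bose–Burton.** If `(#Y + 1)·2^j < 2^{k+1}` there are `v_1, …, v_j ∈ 𝔽₂^k` whose non-trivial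
linear combinations are all non-zero and outside `Y`. [cite: BoseBurton1966, Thm. 1 (case q = 2; elementary greedy proof here)] -/
theorem exists_lcomb_avoiding (Y : Finset (Fin k → Bool)) :
    ∀ j : ℕ, (#Y + 1) * 2 ^ j < 2 ^ (k + 1) →
      ∃ v : Fin j → (Fin k → Bool), ∀ s : Fin j → Bool, s ≠ (fun _ => false) →
        lcomb j v s ≠ zeroVec ∧ lcomb j v s ∉ Y := by
  classical
  intro j
  induction j with
  | zero =>
    intro _
    exact ⟨fun i => i.elim0, fun s hs => absurd (funext fun i => i.elim0) hs⟩
  | succ j ih =>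
    intro hj
    have hj' : (#Y + 1) * 2 ^ j < 2 ^ k := by
      have e : (#Y + 1) * 2 ^ (j + 1) = (#Y + 1) * 2 ^ j * 2 := by rw [pow_succ]; ring
      rw [e, pow_succ] at hj
      exact Nat.lt_of_mul_lt_mul_right hj
    have hjw : (#Y + 1) * 2 ^ j < 2 ^ (k + 1) :=
      lt_of_lt_of_le hj' (Nat.pow_le_pow_right (by norm_num) (Nat.le_succ k))
    obtain ⟨v, hv⟩ := ih hjw
    -- the forbidden set for the new vector: (Y ∪ {0}) ⊕ span(v)
    let B : Finset (Fin k → Bool) :=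
      ((insert zeroVec Y) ×ˢ (univ : Finset (Fin j → Bool))).image fun p => bxor p.1 (lcomb j v p.2)
    have hB : #B < #(univ : Finset (Fin k → Bool)) := by
      calc #B ≤ #((insert zeroVec Y) ×ˢ (univ : Finset (Fin j → Bool))) := card_image_le
        _ = #(insert zeroVec Y) * 2 ^ j := by
            rw [card_product, card_univ, Fintype.card_fun, Fintype.card_bool, Fintype.card_fin]
        _ ≤ (#Y + 1) * 2 ^ j := Nat.mul_le_mul_right _ (card_insert_le _ _)
        _ < 2 ^ k := hj'
        _ = #(univ : Finset (Fin k → Bool)) := by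
            rw [card_univ, Fintype.card_fun, Fintype.card_bool, Fintype.card_fin]
    obtain ⟨w, -, hw⟩ := exists_mem_notMem_of_card_lt_card hB
    have hwB : ∀ y ∈ insert zeroVec Y, ∀ s : Fin j → Bool, bxor y (lcomb j v s) ≠ w := by
      intro y hy s e
      exact hw (mem_image.mpr ⟨(y, s), mem_product.mpr ⟨hy, mem_univ _⟩, e⟩)
    refine ⟨Fin.cons w v, fun s hs => ?_⟩
    rw [lcomb_cons]
    cases h0 : s 0 with
    | false =>
      have htail : Fin.tail s ≠ fun _ => false := by
        intro ht
        apply hs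
        funext i
        refine Fin.cases h0 (fun i' => ?_) i
        exact congrFun ht i'
      have e : bxor (lcomb j v (Fin.tail s)) (fun x => false && w x) = lcomb j v (Fin.tail s) := by
        funext x; simp [bxor]
      rw [e]
      exact hv _ htail
    | true =>
      have e : bxor (lcomb j v (Fin.tail s)) (fun x => true && w x) = bxor (lcomb j v (Fin.tail s)) w := by
        funext x; simp [bxor]
      rw [e]
      refine ⟨fun h => ?_, fun h => ?_⟩
      · -- `u ⊕ w = 0` would put `w = 0 ⊕ u` into the forbidden set
        refine hwB zeroVec (mem_insert_self _ _) (Fin.tail s) ?_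
        funext x
        have hx := congrFun h x
        change (lcomb j v (Fin.tail s) x ^^ w x) = false at hx
        change (false ^^ lcomb j v (Fin.tail s) x) = w x
        revert hx
        cases lcomb j v (Fin.tail s) x <;> cases w x <;> decide
      · -- `u ⊕ w = y ∈ Y` would put `w = y ⊕ u` into the forbidden set
        refine hwB _ (mem_insert_of_mem h) (Fin.tail s) ?_
        funext x
        change ((lcomb j v (Fin.tail s) x ^^ w x) ^^ lcomb j v (Fin.tail s) x) = w x
        cases lcomb j v (Fin.tail s) x <;> cases w x <;> decide

/-- **Isolating flat.** If `t ∈ N ⊆ 𝔽₂^k` and `#N · 2^j < 2^{k+1}` (`#N < 2^{k-j+1}`), there are linearly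
independent `v_1, …, v_j` such that the `j`-flat `t ⊕ span(v)` meets `N` only in `t`. -/
theorem exists_isolating_flat (N : Finset (Fin k → Bool)) (t : Fin k → Bool) (ht : t ∈ N) (j : ℕ)
    (hN : #N * 2 ^ j < 2 ^ (k + 1)) :
    ∃ v : Fin j → (Fin k → Bool), ∀ s : Fin j → Bool, s ≠ (fun _ => false) →
      lcomb j v s ≠ zeroVec ∧ bxor t (lcomb j v s) ∉ N := by
  classical
  let Y : Finset (Fin k → Bool) := (N.erase t).image fun y => bxor t y
  have hY : (#Y + 1) * 2 ^ j < 2 ^ (k + 1) := by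
    have h1 : #Y + 1 ≤ #N := by
      calc #Y + 1 ≤ #(N.erase t) + 1 := Nat.add_le_add_right card_image_le 1
        _ = #N := card_erase_add_one ht
    exact lt_of_le_of_lt (Nat.mul_le_mul_right _ h1) hN
  obtain ⟨v, hv⟩ := exists_lcomb_avoiding Y j hY
  refine ⟨v, fun s hs => ⟨(hv s hs).1, fun hmem => (hv s hs).2 ?_⟩⟩
  have hne : bxor t (lcomb j v s) ≠ t := by
    intro e
    apply (hv s hs).1
    funext x
    have hx := congrFun e x
    change (t x ^^ lcomb j v s x) = t x at hx
    change lcomb j v s x = false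
    revert hx
    cases lcomb j v s x <;> cases t x <;> decide
  refine mem_image.mpr ⟨bxor t (lcomb j v s), mem_erase.mpr ⟨hne, hmem⟩, ?_⟩
  exact BuzetChailloux.bxor_bxor_cancel_left t _

/-- Each coordinate of `s ↦ Σ s_i v_i` is affine (indeed linear) in `s`. -/
theorem lcomb_isDegLeFun : ∀ (j : ℕ) (v : Fin j → (Fin k → Bool)) (x : Fin k),
    IsDegLeFun 1 (fun s : Fin j → Bool => lcomb j v s x) := by
  intro j
  induction j with
  | zero => intro v x; exact isDegLeFun_const 1 false
  | succ j ih =>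
    intro v x
    have h1 : IsDegLeFun 1 (fun s : Fin (j + 1) → Bool => lcomb j (Fin.tail v) (Fin.tail s) x) :=
      fc_isDegLeFun_comp (ih (Fin.tail v) x) (fun s : Fin (j + 1) → Bool => Fin.tail s)
        (fun i => isDegLeFun_apply i.succ le_rfl) le_rfl
    have h2 : IsDegLeFun 1 (fun s : Fin (j + 1) → Bool => s 0 && v 0 x) := by
      cases v 0 x with
      | true => simpa using (isDegLeFun_apply (0 : Fin (j + 1)) le_rfl : IsDegLeFun 1 fun s : Fin (j + 1) → Bool => s 0)
      | false => simpa using (isDegLeFun_const 1 false : IsDegLeFun 1 fun _ : Fin (j + 1) → Bool => false)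
    exact fc_deg_bxor h1 h2

/-- Each coordinate of the affine chart `s ↦ t ⊕ Σ s_i v_i` of the flat `t ⊕ span(v)` has degree `≤ 1`. -/
theorem chart_isDegLeFun (j : ℕ) (t : Fin k → Bool) (v : Fin j → (Fin k → Bool)) (x : Fin k) :
    IsDegLeFun 1 (fun s : Fin j → Bool => bxor t (lcomb j v s) x) :=
  fc_deg_bxor (isDegLeFun_const 1 (t x)) (lcomb_isDegLeFun j v x)

end Summit.QuantumAdvantage.QuantumAdvantage.Theorems.NearExactIsExact.Negative.XorSpanAvoid
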